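import Summits.CriticalPhenomena.PercolationContinuityZ3.Theorems.Transplant.SkelPhiRouteChainFacts
import Summits.CriticalPhenomena.PercolationContinuityZ3.Theorems.Transplant.SkelPhiWinChainFactsF
import HarnessLib

/-!
# N2 (frames-only node), (S0) kit tier, (F) spine part 2 (hp-8 g39): **(S0) CHAIN FACTS OF A SEGMENT UNDER THE ROUTE LAW, AND THE ROUTE DATUM
# FROM (S0) CHAIN FACTS** — the F-twin of `SkelPhiRouteChainFacts` (hp-8 g33): `chainFactsF_seg_routeW` (one schedule-frame segment read through a
# planar window of `winGraph G c L` under `Skel.routeW G Wt Qt S`, per-level FORCED-kit clauses) and `linkIn_of_chainFactsF` (the chain property over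
# `KitsAtF` steps applied once: `1 − ε < P_{Wt}(linkIn Qt S Ft)`)

builds on p205010 (kernel theorem, internal audit signed; external expert review pending) — nothing in this file uses p205010; nothing here is a
claim about the open node `SamePDropOfSkeletonFrm₁`.
Lane `prim-bschramm`, seat `prim-hp-8` (gen 39); helper file (`--supports stmt-CriticalPhenomena-4575 --as helper`); F-PORT-JUNCTIONS (hp-8 g37).
Port rule ((S0)): `KitsAt ↦ KitsAtF` in `hchain`; the per-level `hkits` package is `kitsAt_stepAFF`'s; `ChainFacts ↦ ChainFactsF`; proofs verbatim.
* **`chainFactsF_seg_routeW`**, **`linkIn_of_chainFactsF`**.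
[cite: KozmaNitzan2024, §4 Lemma 11 (pp. 22–23), Lemma 12 (pp. 23–25), p. 24 (P(o ↔^A ·)), p. 20 (Step IV)] [this work]
-/

noncomputable section

open MeasureTheory ProbabilityTheory
open scoped ENNReal

namespace Summit.CriticalPhenomena.PercolationContinuityZ3.Theorems.Transplant

namespace Skelφ

open Literature.Probability.Percolation Literature.Probability.LatticeModels SimpleGraph
open Literature.Probability.Percolation.KozmaNitzan
open KNLevels ChainPlanar
open Literature.Barriers.CriticalPhenomena (graphBall graphBall_mono)
open Skel (winGraph routeW)

variable {V : Type} [DecidableEq V] {G : SimpleGraph V} [G.LocallyFinite]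

/-- **ONE SEGMENT UNDER THE ROUTE LAW, (S0)-SHAPE KITS**: face-step law `Wt` (subbox of `winGraph G w₀ R` on `Rg`), route world `Qt ⊆ Rg` inside
`B(c, L)`, wired seed `S ∋ c` in `Qt`; a schedule frame `Sch` read through a planar window `𝒲` of `winGraph G c L` with chain data `P` (source `c`,
support `Qt`) whose region windows lie in `Qt` off `S`; counts / per-level forced-kit clauses / rim excess under `routeW G Wt Qt S` ⟹ the (S0) chain
facts of the segment under the route law. [cite: KozmaNitzan2024, §4 Lemma 11 (pp. 22–23), Lemma 12 (pp. 23–25)] [this work] -/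
theorem chainFactsF_seg_routeW {w₀ c : V} {R L : ℕ} {Wt : Sym2 V → unitInterval} {q : unitInterval} {Rg Qt S : Finset V}
    (hWG : ∀ e, e ∉ G.edgeSet → Wt e = 0) (hWD : IsSubbox (winGraph G w₀ R) Wt q Rg) (hRg : ∀ u ∈ Rg, u ∈ graphBall G w₀ R)
    (hQ : Qt ⊆ Rg) (hQL : ∀ u ∈ Qt, u ∈ graphBall G c L) (hSQ : S ⊆ Qt) (hcS : c ∈ S)
    (𝒲 : PlanarWindow (winGraph G c L)) (Sch : SchedFrame) (P : WinChainData V) (hPo : P.o = c) (hPS : P.Sfin = Qt)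
    (hRl : P.Rlev + 1 ≤ Sch.R') (hRim : ∀ k, P.Rim k ⊆ 𝒲.stepDF Sch k) (hTne : ∀ k ≤ Sch.N, (𝒲.coreTF Sch k).Nonempty) (hj : P.j₁ ≤ P.Rlev)
    (hDQ : ∀ k ≤ Sch.N, 𝒲.stepDF Sch k ⊆ Qt) (hDS : ∀ k ≤ Sch.N, Disjoint S (𝒲.stepDF Sch k)) {Δ' : ℕ} {δ η : ℝ}
    (hcount : 1 / (1 - (q : ℝ)) ^ (Δ' * P.N) ≤ δ * ((Finset.Icc P.j₀ P.j₁).card : ℝ))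
    (hkits : ∀ k ≤ Sch.N, ∀ j ∈ Finset.Icc P.j₀ P.j₁, ∃ (σ : SData V) (Sz : Finset V),
      SHyp (P.stepLF 𝒲 Sch k) j σ ∧ σ.N ≤ P.N ∧ (1 - (q : ℝ) ^ σ.sB) ^ σ.k ≤ δ ∧ Sz ⊆ 𝒲.stepDF Sch k ∧ (∀ x ∈ σ.K, σ.face x ⊆ Sz) ∧
      RelayClause (P.stepLF 𝒲 Sch k) (routeW G Wt Qt S) j σ Sz (P.coreEF 𝒲 Sch k) (𝒲.stepDF Sch k) δ)
    (hexc : ∀ k ≤ Sch.N, (prodBernoulli (routeW G Wt Qt S)).real (⋃ t ∈ P.Rim k, openConn c t) ≤ η) :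
    ChainFactsF (routeW G Wt Qt S) q Δ' δ η c (fun k => P.stepAF 𝒲 Sch k) (fun k => 𝒲.coreTF Sch k) Sch.N := by
  have hsub : ∀ k ≤ Sch.N, IsSubbox (winGraph G c L) (routeW G Wt Qt S) q (𝒲.stepDF Sch k) := fun k hk =>
    Skel.isSubbox_routeW G hWG (hDQ k hk) hQL (fun u hu => hRg u (hQ (hDQ k hk hu))) (hDS k hk) (hWD.anti ((hDQ k hk).trans hQ))
  have hfin : FinSupp (routeW G Wt Qt S) P.Sfin := by rw [hPS]; exact Skel.finSupp_routeW G Wt Qt S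
  have ho : ∀ k ≤ Sch.N, P.o ∉ 𝒲.stepDF Sch k := fun k hk h => by
    rw [hPo] at h; exact Finset.disjoint_left.1 (hDS k hk) hcS h
  have hoS : P.o ∈ P.Sfin := by rw [hPo, hPS]; exact hSQ hcS
  have hexc' : ∀ k ≤ Sch.N, (prodBernoulli (routeW G Wt Qt S)).real (⋃ t ∈ P.Rim k, openConn P.o t) ≤ η := by rw [hPo]; exact hexc
  have key := P.chainFactsF_seg 𝒲 Sch hRl hRim hTne hsub hfin (fun k hk => by rw [hPS]; exact hDQ k hk) ho hoS hj hcount hkits hexc'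
  rw [hPo] at key
  exact key

/-- **THE ROUTE DATUM FROM (S0) CHAIN FACTS UNDER THE ROUTE LAW**: the (S0) chain facts of a family of length `n + 1` under `routeW G Wt Qt S` with
source `c ∈ S` (internally connected seed, `S ⊆ U ⊆ Qt`), a `P_q` hop from a sub-seed `S₀` into the first level, the chain property at `(δ ↦ ε)` over
`KitsAtF` steps, the last true target inside `Ft` off `S` ⟹ `1 − ε < P_{Wt}(linkIn Qt S Ft)`.
[cite: KozmaNitzan2024, §4 Lemma 11 (pp. 22–23), Lemma 12, p. 24] [this work] -/
theorem linkIn_of_chainFactsF [Countable V] {w₀ c : V} {R L : ℕ} {Wt : Sym2 V → unitInterval} {q : unitInterval} {Rg Qt S : Finset V}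
    (hWD : IsSubbox (winGraph G w₀ R) Wt q Rg) (hRg : ∀ u ∈ Rg, u ∈ graphBall G w₀ R) (hQ : Qt ⊆ Rg)
    (hSQ : S ⊆ Qt) (hcS : c ∈ S) (hconn : ∀ s ∈ S, PathIn G (↑S : Set V) c s)
    {s : ℕ → TStep (winGraph G c L)} {T' : ℕ → Finset V} {n Δ' : ℕ} {δ η ε : ℝ}
    (hF : ChainFactsF (routeW G Wt Qt S) q Δ' δ η c s T' n)
    (hchain : ∀ (W : Sym2 V → unitInterval) (s : Fin (n + 1) → TStep (winGraph G c L)) (T' : Fin (n + 1) → Finset V) (η : ℝ),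
      (∀ i, (s i).L.o = (s 0).L.o) →
      (∀ i : Fin n, T' (Fin.castSucc i) ⊆ (s i.succ).L.X 0) →
      (∀ i, T' i ⊆ (s i).T) →
      (∀ i, (s i).KitsAtF W q Δ' δ) →
      η ≤ δ / 2 →
      (∀ i, (prodBernoulli W).real (⋃ t ∈ (s i).T \ T' i, openConn (s 0).L.o t) ≤ η) →
      1 - δ < (prodBernoulli W).real (s 0).L.reachB →
        1 - ε < (prodBernoulli W).real (⋃ t ∈ T' (Fin.last n), openConn (s 0).L.o t))
    (hη : η ≤ δ / 2)
    -- the hop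
    {U S₀ T₀ : Finset V} (hUQ : U ⊆ Qt) (hS₀ : S₀ ⊆ S) (hSU : S ⊆ U) (hT₀ : T₀ ⊆ (s 0).L.X 0)
    (hlink : 1 - δ < (bondPercolation G q).real (linkIn (↑U : Set V) S₀ T₀))
    -- the last true target
    {Ft : Finset V} (hTn : T' n ⊆ Ft) (hSF : Disjoint S Ft) :
    1 - ε < (prodBernoulli Wt).real (linkIn (↑Qt : Set V) S Ft) :=
  hF.lt_real_linkIn G hchain hη hT₀ (Skel.hsrc_routeW_of_linkIn hWD hRg hUQ (hUQ.trans hQ) hSQ hS₀ hSU hconn subset_rfl hlink) hTn hSQ hSF hcS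

end Skelφ

end Summit.CriticalPhenomena.PercolationContinuityZ3.Theorems.Transplant

end
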